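import Summits.ResolutionOfSingularities.ResolutionOfSingularities.Theorems.EquisingularLiftCampaignW45bBadPointCriterion
import Summits.ResolutionOfSingularities.ResolutionOfSingularities.Theorems.EquisingularLiftCampaignW45bAvoidBadPoint
import HarnessLib

/-!
# [OURS · L1 W4.5(b)] T-AVOID-SCHEME: the strict transform of an equimultiple hypersurface meets `Bl_{V(e,w)}` only in regular points

Crux chain w45b, working crux EL♮ = `Theses.EquisingularLift.EquisingularLiftNat` (stmt-ResolutionOfSingularities-20038), stub
`stub_elnat_three_isolated`; composition of AVOID-L1 (`…CampaignW45bAvoidBadPoint`, p501026) with L2 / L2-SCHEME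
(`…CampaignW45bBadPointCriterionChart` p507498, `…CampaignW45bBadPointCriterion` p508624) in the dictionary currency of
`…CampaignW45bBlowupStalkDictionary` (p506193). OURS; NOT a statement of any manuscript; AI-written, weaker than expert review.
`--supports stmt-ResolutionOfSingularities-20038 --as helper`.

SETTING: `π : X′ → X` a blowing up along `J`, `x′ ∈ X′` over `s`, `S = 𝒪_{X,s}` regular local with algebraically closed residue field,
`J_s = (e, w)`, `e ∈ 𝔪 ∖ 𝔪²`, `w ∈ 𝔪²`, `w ∉ (e)`, and an EQUIMULTIPLE hypersurface equation `y ∈ (e, w)^ν ∖ 𝔪^{ν+1}` (multiplicity `ν`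
at `s` and along `Z = V(e, w)`). «`x′` lies on the strict transform of `V(y)`» is the intrinsic condition
`π♯y ∈ (π♯e, π♯w)^ν · 𝔪_{x′}` (`= E^ν · 𝔪_{x′}`, `E = J·𝒪_{X′,x′}` the exceptional ideal, invertible).

* `algebraMap_pow_mul_divPow` — `eⁿ · (y/eⁿ) = y` in `R[I/e]`;
* **`gen_notMem_of_strictTransform`** (ring core, abstract dictionary `σ, χ, φ`) — at a prime `𝔔 ⊇ 𝔪B` of the `e`-chart presenting
  `𝒪_{X′,x′}`, the strict-transform condition forces `w/e ∉ 𝔔`: otherwise `𝔔` is the bad point, `y/e^ν` is a unit there (AVOID-L1)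
  while `π♯y = (π♯e)^ν · m` with `m ∈ 𝔪_{x′}` gives `y/e^ν ↦ m` — absurd;
* **`isRegularLocalRing_stalk_of_strictTransform`** — MAIN: every point `x′` over `s` on the strict transform of `V(y)` is a REGULAR
  point of `X′`; `isRegularLocalRing_stalk_of_eq_pow_mul` — the same with an explicit factorisation `π♯y = g^ν · ỹ`, `g ∈ (π♯e, π♯w)`,
  `ỹ ∈ 𝔪_{x′}`.
So after a Δ-step / comb step with centre trace `V(e, w)`, sections and further centres placed ON THE STRICT TRANSFORM of the
hypersurface never meet the bad point (CRUX-PLAN v1.1 §3.4 L1 «AVOID» + L2, scheme level).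

References: res-L1-w45b-plan-1 CRUX-PLAN v1.1 §3.4 L1/L2 (OURS); The Stacks Project, Tag 0804, 052Q — context.
-/

noncomputable section

set_option linter.dupNamespace false -- mandated namespace `Summit.<Summit>.<Problem>` of this single-conjunct summit

open CategoryTheory AlgebraicGeometry TopologicalSpace IsLocalRing IsLocalization
open Literature.AlgebraicGeometry.Resolution

namespace Summit.ResolutionOfSingularities.ResolutionOfSingularities.Cruxes.EquisingularLiftNat.Sections

universe u

section Chart

variable {R : Type u} [CommRing R]

/-- `eⁿ · (y/eⁿ) = y` in `R[I/e]`. [cite: StacksProject, Tag 052Q] -/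
theorem algebraMap_pow_mul_divPow (I : Ideal R) (g : R) {n : ℕ} {y : R} (hy : y ∈ I ^ n) :
    algebraMap R (blowupAlgebra I g) g ^ n * blowupAlgebra.divPow I g hy = algebraMap R (blowupAlgebra I g) y := by
  apply Subtype.ext
  simp only [Subalgebra.coe_mul, Subalgebra.coe_pow, Subalgebra.coe_algebraMap, blowupAlgebra.coe_divPow]
  rw [mul_left_comm, ← map_pow, algebraMap_pow_mul_invSelf_pow, mul_one]

variable [IsRegularLocalRing R] {e w y : R} {ν : ℕ}

/-- At a prime `𝔔 ⊇ 𝔪B` of the `e`-chart containing `w/e` (i.e. at the bad point), `y/e^ν` is a unit of `B_𝔔` for an equimultiple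
`y ∈ (e, w)^ν ∖ 𝔪^{ν+1}` (AVOID-L1, localized). [folklore; CRUX-PLAN v1.1 §3.4 L1] -/
theorem isUnit_algebraMap_divPow_of_gen_mem (he : e ∈ maximalIdeal R) (he₂ : e ∉ maximalIdeal R ^ 2)
    (hw : w ∈ maximalIdeal R ^ 2) (hwe : w ∉ Ideal.span {e}) (hy : y ∈ Ideal.span {e, w} ^ ν)
    (hy' : y ∉ maximalIdeal R ^ (ν + 1)) (𝔔 : Ideal (blowupAlgebra (Ideal.span {e, w}) e)) [𝔔.IsPrime]
    (hm : (maximalIdeal R).map (algebraMap R (blowupAlgebra (Ideal.span {e, w}) e)) ≤ 𝔔)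
    (ht : blowupAlgebra.gen (Ideal.span {e, w}) e w (mem_span_pair_right e w) ∈ 𝔔) :
    IsUnit (algebraMap _ (Localization.AtPrime 𝔔) (blowupAlgebra.divPow (Ideal.span {e, w}) e hy)) :=
  (IsLocalization.AtPrime.isUnit_to_map_iff (Localization.AtPrime 𝔔) 𝔔 _).mpr
    (divPow_notMem_of_le he he₂ hw hwe hy hy' 𝔔 Ideal.IsPrime.ne_top' hm ht)

/-- **Ring core of T-AVOID-SCHEME** (abstract dictionary). Let `S′` be a local ring presented as `S′ ≃ B_𝔔` (`B = R[Z/e]`,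
`𝔔 ⊇ 𝔪B` prime) compatibly with `σ : R → S′` and `χ : B → S′`. If `σ y ∈ (σ e, σ w)^ν · 𝔪_{S′}` («the point lies on the strict
transform of `V(y)`») for an equimultiple `y ∈ (e, w)^ν ∖ 𝔪^{ν+1}`, then `w/e ∉ 𝔔` — the point is not the bad point.
[folklore; CRUX-PLAN v1.1 §3.4 L1+L2] -/
theorem gen_notMem_of_strictTransform {S' : Type u} [CommRing S'] [IsLocalRing S']
    (he : e ∈ maximalIdeal R) (he₂ : e ∉ maximalIdeal R ^ 2)
    (hw : w ∈ maximalIdeal R ^ 2) (hwe : w ∉ Ideal.span {e}) (hy : y ∈ Ideal.span {e, w} ^ ν)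
    (hy' : y ∉ maximalIdeal R ^ (ν + 1)) (𝔔 : Ideal (blowupAlgebra (Ideal.span {e, w}) e)) [𝔔.IsPrime]
    (hm : (maximalIdeal R).map (algebraMap R (blowupAlgebra (Ideal.span {e, w}) e)) ≤ 𝔔)
    (σ : R →+* S') (χ : blowupAlgebra (Ideal.span {e, w}) e →+* S') (φ : S' ≃+* Localization.AtPrime 𝔔)
    (hχ : ∀ a, χ (algebraMap R _ a) = σ a) (hφ : ∀ b, φ (χ b) = algebraMap _ (Localization.AtPrime 𝔔) b)
    (hst : σ y ∈ Ideal.span {σ e, σ w} ^ ν * maximalIdeal S') :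
    blowupAlgebra.gen (Ideal.span {e, w}) e w (mem_span_pair_right e w) ∉ 𝔔 := by
  intro ht
  haveI := isDomain_of_isRegularLocalRing R
  have he0 : e ≠ 0 := by rintro rfl; exact he₂ (Ideal.zero_mem _)
  haveI : IsDomain (Localization.Away e) :=
    IsLocalization.isDomain_localization (powers_le_nonZeroDivisors_of_noZeroDivisors he0)
  haveI : IsDomain (Localization.AtPrime 𝔔) :=
    IsLocalization.isDomain_localization 𝔔.primeCompl_le_nonZeroDivisors
  haveI : IsDomain S' := MulEquiv.isDomain (Localization.AtPrime 𝔔) φ.toMulEquiv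
  set t := blowupAlgebra.gen (Ideal.span {e, w}) e w (mem_span_pair_right e w) with ht_def
  set d := blowupAlgebra.divPow (Ideal.span {e, w}) e hy with hd_def
  -- `y/e^ν` is a unit at the bad point, hence its image `χ d` is a unit of `S′`
  have hunitL := isUnit_algebraMap_divPow_of_gen_mem he he₂ hw hwe hy hy' 𝔔 hm ht
  have hunit : IsUnit (χ d) := by
    rw [← hφ] at hunitL
    simpa using hunitL.map φ.symm
  -- relations transported to `S′`: `σ w = σ e · χ t`, `(σ e)^ν · χ d = σ y`
  have hwt : σ w = σ e * χ t := by
    rw [← hχ, ← hχ, ← map_mul, blowupAlgebra.algebraMap_mul_gen]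
  have hyd : σ e ^ ν * χ d = σ y := by
    rw [← hχ, ← hχ, ← map_pow, ← map_mul, algebraMap_pow_mul_divPow]
  -- `σ e ≠ 0` in the domain `S′`
  have heB : algebraMap R (blowupAlgebra (Ideal.span {e, w}) e) e ≠ 0 := by
    intro h
    apply he0
    have hinjL : Function.Injective (algebraMap R (Localization.Away e)) :=
      IsLocalization.injective _ (powers_le_nonZeroDivisors_of_noZeroDivisors he0)
    apply hinjL
    have h' := congrArg (Subtype.val : blowupAlgebra (Ideal.span {e, w}) e → Localization.Away e) h
    simpa [Subalgebra.coe_algebraMap] using h'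
  have heS : σ e ≠ 0 := by
    intro h
    apply heB
    apply IsLocalization.injective (Localization.AtPrime 𝔔) 𝔔.primeCompl_le_nonZeroDivisors
    rw [map_zero, ← hφ, hχ, h, map_zero]
  -- the strict-transform condition at the bad point: `σ y = (σ e)^ν · m`, `m ∈ 𝔪_{S′}`
  have hle : Ideal.span {σ e, σ w} ≤ Ideal.span {σ e} := by
    rw [Ideal.span_le]
    rintro z (rfl | rfl)
    · exact Ideal.subset_span rfl
    · exact Ideal.mem_span_singleton.mpr ⟨χ t, hwt⟩
  have hst' : σ y ∈ Ideal.span {σ e ^ ν} * maximalIdeal S' := by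
    rw [← Ideal.span_singleton_pow]
    exact Ideal.mul_mono_left (Ideal.pow_right_mono hle ν) hst
  obtain ⟨m, hm𝔪, hym⟩ := Ideal.mem_span_singleton_mul.mp hst'
  -- cancel `(σ e)^ν`: `χ d = m ∈ 𝔪_{S′}`, contradicting that `χ d` is a unit
  have hdm : χ d = m := mul_left_cancel₀ (pow_ne_zero ν heS) (hyd.trans hym.symm)
  exact (maximalIdeal.isMaximal S').ne_top (Ideal.eq_top_of_isUnit_mem _ (hdm ▸ hm𝔪 : χ d ∈ maximalIdeal S') hunit)

end Chart

/-! ## Scheme level -/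

variable {X' X : Scheme.{u}} {π : X' ⟶ X} {J : X.IdealSheafData}

/-- **T-AVOID-SCHEME.** Let `π : X′ → X` be a blowing up along `J`, `x′ ∈ X′` over `s`, `𝒪_{X,s}` regular local with algebraically
closed residue field, `J_s = (e, w)` with `e ∈ 𝔪 ∖ 𝔪²`, `w ∈ 𝔪²`, `w ∉ (e)`, and `y ∈ (e, w)^ν ∖ 𝔪^{ν+1}` an equimultiple hypersurface
equation. If `x′` lies on the strict transform of `V(y)` — `π♯y ∈ (π♯e, π♯w)^ν · 𝔪_{x′}` — then `𝒪_{X′,x′}` is a regular local ring.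
[folklore; CRUX-PLAN v1.1 §3.4 L1 «AVOID» + L2, scheme level] -/
theorem isRegularLocalRing_stalk_of_strictTransform (hπ : IsBlowup π J) (x' : X')
    [IsRegularLocalRing (X.presheaf.stalk (π x'))] [IsAlgClosed (ResidueField (X.presheaf.stalk (π x')))]
    {e w y : X.presheaf.stalk (π x')} {ν : ℕ} (he : e ∈ maximalIdeal (X.presheaf.stalk (π x')))
    (he₂ : e ∉ maximalIdeal (X.presheaf.stalk (π x')) ^ 2) (hw : w ∈ maximalIdeal (X.presheaf.stalk (π x')) ^ 2)
    (hwe : w ∉ Ideal.span {e}) (hJ : Ideal.span {e, w} = stalkIdeal J (π x'))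
    (hy : y ∈ Ideal.span {e, w} ^ ν) (hy' : y ∉ maximalIdeal (X.presheaf.stalk (π x')) ^ (ν + 1))
    (hst : (π.stalkMap x').hom y ∈
      Ideal.span {(π.stalkMap x').hom e, (π.stalkMap x').hom w} ^ ν * maximalIdeal (X'.presheaf.stalk x')) :
    IsRegularLocalRing (X'.presheaf.stalk x') := by
  rcases exists_blowupAlgebra_stalk_ringEquiv_pair hπ x' e w hJ with ⟨𝔔, χ, φ, hχ, hφ, h𝔔⟩ | ⟨𝔔, χ, φ, hχ, hφ, h𝔔⟩
  · -- the `e`-chart: the strict transform misses the bad point, every other point is regular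
    have hm : (maximalIdeal (X.presheaf.stalk (π x'))).map
        (algebraMap (X.presheaf.stalk (π x')) (blowupAlgebra (Ideal.span {e, w}) e)) ≤ 𝔔.asIdeal :=
      Ideal.map_le_iff_le_comap.mpr h𝔔.ge
    have ht := gen_notMem_of_strictTransform he he₂ hw hwe hy hy' 𝔔.asIdeal hm (π.stalkMap x').hom χ φ hχ hφ hst
    exact @IsRegularLocalRing.of_ringEquiv _ _
      ((isRegularLocalRing_localization_eChart_iff he he₂ hw hwe 𝔔.asIdeal hm).mpr ht) _ _ φ.symm
  · -- the `w`-chart: every point is regular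
    have hm : (maximalIdeal (X.presheaf.stalk (π x'))).map
        (algebraMap (X.presheaf.stalk (π x')) (blowupAlgebra (Ideal.span {e, w}) w)) ≤ 𝔔.asIdeal :=
      Ideal.map_le_iff_le_comap.mpr h𝔔.ge
    exact @IsRegularLocalRing.of_ringEquiv _ _
      (isRegularLocalRing_localization_wChart' he he₂ hw hwe 𝔔.asIdeal hm) _ _ φ.symm

/-- **T-AVOID-SCHEME, factorised form.** Same setting; if `π♯y = g^ν · ỹ` with `g ∈ (π♯e, π♯w)` (e.g. a generator of the
exceptional ideal at `x′`) and `ỹ ∈ 𝔪_{x′}` (the strict transform `ỹ` of the equation vanishes at `x′`), then `𝒪_{X′,x′}` is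
regular. [folklore; CRUX-PLAN v1.1 §3.4 L1+L2] -/
theorem isRegularLocalRing_stalk_of_eq_pow_mul (hπ : IsBlowup π J) (x' : X')
    [IsRegularLocalRing (X.presheaf.stalk (π x'))] [IsAlgClosed (ResidueField (X.presheaf.stalk (π x')))]
    {e w y : X.presheaf.stalk (π x')} {ν : ℕ} (he : e ∈ maximalIdeal (X.presheaf.stalk (π x')))
    (he₂ : e ∉ maximalIdeal (X.presheaf.stalk (π x')) ^ 2) (hw : w ∈ maximalIdeal (X.presheaf.stalk (π x')) ^ 2)
    (hwe : w ∉ Ideal.span {e}) (hJ : Ideal.span {e, w} = stalkIdeal J (π x'))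
    (hy : y ∈ Ideal.span {e, w} ^ ν) (hy' : y ∉ maximalIdeal (X.presheaf.stalk (π x')) ^ (ν + 1))
    {g z : X'.presheaf.stalk x'} (hg : g ∈ Ideal.span {(π.stalkMap x').hom e, (π.stalkMap x').hom w})
    (hz : z ∈ maximalIdeal (X'.presheaf.stalk x')) (hfac : (π.stalkMap x').hom y = g ^ ν * z) :
    IsRegularLocalRing (X'.presheaf.stalk x') :=
  isRegularLocalRing_stalk_of_strictTransform hπ x' he he₂ hw hwe hJ hy hy'
    (hfac ▸ Ideal.mul_mem_mul (Ideal.pow_mem_pow hg ν) hz)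

end Summit.ResolutionOfSingularities.ResolutionOfSingularities.Cruxes.EquisingularLiftNat.Sections

end
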